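import Literature.NumberTheory.Automorphic.Liu2021.LemD1AsPrintedIndexedNonVacuityNonsplitPlace   -- ★ `exists_not_isNorm_of_nonsplit` (a non-norm of `L⁺_v` at a non-split `v`)
import Literature.NumberTheory.GelbartRogawski1991.UnitaryDualPairThetaKernelCM                 -- ★ `imagUnit`, `complexConj_imagUnit`, `imagUnit_ne_zero`
import Literature.NumberTheory.Automorphic.QuadraticLocalBaseChange                              -- ★ `toLocalRing`, `toLocalRing_coe`, `conjLocal_toLocalRing`, `algebraMap_localRing_eq`
import Literature.AlgebraicGeometry.Liu2021.AdmissibleElementPrescribedLocalClass                  -- ★ p848354 (WAᴸ-2, LH10-p02): `exists_isAdmissibleElement_algebraMap_mul_eq_mul_sq`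
import Summits.HodgeConjecture.HodgeConjecture.Theorems.F0P3cDbTSupercuspidalOffOccurringClass      -- ★ p848292 (SCᴸ, this seat): `exists_line_forall_isSupercuspidal_xThetaCM_of_not_isNorm`
import HarnessLib

/-!
# F0 · P3c · line LH10 «(D-b)ᵀ» — (NNᴸ): THE NON-NORM CLASS GLUE between (WAᴸ-2) ★ `AdmissibleElementPrescribedLocalClass` and (SCᴸ) ★
# `F0P3cDbTSupercuspidalOffOccurringClass` (organ (O1)'s in-house road, step «put the global line `a` in the class `ε₀ · (non-norm)` at `v`»)

Cell `pub/hodgecm-mathlib`, crux H413 = `stmt-HodgeConjecture-24833` (lane `--supports`), route HCCMUnconditional; seat LH10-p01 (g0); TAKEN on the squad bus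
`F0/P3c/STATUS.md` 2026-09-02T03:2xZ on LH10-p02 (g0)'s 03:18:52Z ask («(NNᴸ: a non-norm unit at non-split v + square-class → `conjLocal` currency bridge)») for the
(O1-RED) ∕ (N1) assembly of line LH10 (skeleton `Cruxes/H413/Lines/F0_P3c_DbTPaydown.lean` ED. 3 d3cbdbee300025aa, organ (O1) `stub_thetaLiftMember`).  THEOREMS ONLY,
sorry-free, no definition ∕ instance ∕ notation ∕ named fact.  HONEST LABEL: HC_CM is proved only modulo the printed citations (2 remaining named inputs hLiu418 24832, h413
24833) until rung 0 closes; this file proves NO printed statement — it is local-field bookkeeping over ★ theorems of the tree.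

THE GLUE.  `L` a CM field, `L⁺` its maximal real subfield, `v` a finite place of `L⁺` NOT split in `L`, `L_v := L ⊗ L⁺_v = ∏_{w ∣ v} L_w` (★ `UnitaryGroup.LocalRing L v`)
with its conjugation `σ_v = c ⊗ 1` (★ `conjLocal`) and structure map `ι_v : L⁺_v → L_v` (★ `toLocalRing` = `algebraMap`).  The weak-approximation organ (WAᴸ-2, ★
`Liu2021.exists_isAdmissibleElement_algebraMap_mul_eq_mul_sq … v κ`) produces, for ANY unit `κ` of `L⁺_v`, a global line `a ∈ (L⁺)ˣ` (admissible at the real places) with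
`a = κ · s²` in `L⁺_v`; the supercuspidality organ (SCᴸ, ★ `exists_line_forall_isSupercuspidal_xThetaCM_of_not_isNorm`) wants `a · ε₀⁻¹` NOT a norm `x · σ_v x`, `x ∈ L_vˣ`, read
on `algebraMap L L_v ((a ε₀⁻¹ : L⁺) : L)` (the currency of ★ `u1Disjoint_of_letters`).  §2 supplies THE `κ`: `κ := ι(ε₀) · κ₀` with `κ₀` a non-norm of `L⁺_v` (★
`exists_not_isNorm_of_nonsplit`: the local norm index is `2` at a non-split place, [Omeara1963 63:13a]); then `a ε₀⁻¹ = κ₀ · s²` in `L⁺_v`, `ι_v(s)² = ι_v(s) · σ_v ι_v(s)` IS a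
norm, norms from `L_vˣ` form a subgroup (§1), so `a ε₀⁻¹` is a norm iff `κ₀` is — it is not.

* §1 `not_exists_mul_conjLocal_eq_mul_of_not` — «non-norm · norm is a non-norm» in `L_v`; `exists_units_mul_conjLocal_eq_toLocalRing_sq` — `ι_v(s²)` is a norm.
* §2 `algebraMap_coe_maximalRealSubfield_eq_toLocalRing` — currency: `algebraMap L L_v ((t : L⁺) : L) = ι_v (t : L⁺_v)`;
  **`exists_kappa_forall_not_isNorm_nonsplit`** — THE GLUE (∃ κ, ∀ a s, `ι a = κ s²` → `a ε₀⁻¹` is a non-norm, in (SCᴸ)'s currency verbatim).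
* §3 **`exists_isAdmissibleElement_isSupercuspidal_xThetaCM`** — the COMPOSITION (WAᴸ-2) ∘ (NNᴸ) ∘ (SCᴸ): ∃ a global line `a`, `a·δ` admissible for `Φ` ∧ `X_v(μ, a, χ_f)`
  supercuspidal — hypothesis-free; the one term the (O1-RED)∕(N1) assembly needs at `v`.

## References
* [Omeara1963] O. T. O'Meara, *Introduction to Quadratic Forms* (1963): §63B Cor. 63:13a (local norm index 2).  [Liu2021] Y. Liu, Camb. J. Math. 9 (2021): App. D §D.1 Step 2.
* [Rogawski1990] J. Rogawski, Ann. of Math. Stud. 123 (1990): §3.8 p. 30; §12.2 (2) pp. 173–174.  [GelbartRogawski1991] Invent. Math. 105: Lem. 5.1.2 p. 466 (the two classes).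
-/

set_option autoImplicit false
-- the mandated namespace has the single-problem summit's repeated segment (`HodgeConjecture.HodgeConjecture`)
set_option linter.dupNamespace false

noncomputable section

open NumberField IsDedekindDomain

open Literature.NumberTheory Literature.NumberTheory.Automorphic Literature.NumberTheory.Automorphic.UnitaryGroup
open Literature.NumberTheory.Automorphic.IdeleClassGroup
open Literature.NumberTheory.Automorphic.Liu2021 Literature.NumberTheory.Automorphic.Liu2021.Def411WeilCarriers
open Literature.NumberTheory.GaloisRepresentations
open Literature.NumberTheory.Rogawski1990
open Literature.NumberTheory.GelbartRogawski1991

namespace Summit.HodgeConjecture.HodgeConjecture.Cruxes.H413.F0P3cDbTNonNormClassGlue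

variable (L : Type) [Field L] [NumberField L] [IsCMField L] (v : HeightOneSpectrum (𝓞 ↥(maximalRealSubfield L)))

/-! ## §1 Norms from `L_vˣ = (L ⊗ L⁺_v)ˣ` form a subgroup containing `ι_v(L⁺_vˣ)²` -/

/-- **«norm · non-norm is a non-norm»** in the commutative ring `L_v = L ⊗ L⁺_v`: if `T` is not of the form `x · σ_v x` (`x` a unit) and `N = y · σ_v y` (`y` a unit),
then `N · T` is not of the form `x · σ_v x` — otherwise `(x y⁻¹) · σ_v (x y⁻¹) = T`. [cite: Omeara1963, §63B Cor. 63:13a] -/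
theorem not_exists_mul_conjLocal_eq_mul_of_not {T N : UnitaryGroup.LocalRing L v}
    (hT : ¬ ∃ x : (UnitaryGroup.LocalRing L v)ˣ, (x : UnitaryGroup.LocalRing L v) * conjLocal L (IsCMField.complexConj L) v x = T)
    (y : (UnitaryGroup.LocalRing L v)ˣ) (hN : (y : UnitaryGroup.LocalRing L v) * conjLocal L (IsCMField.complexConj L) v y = N) :
    ¬ ∃ x : (UnitaryGroup.LocalRing L v)ˣ, (x : UnitaryGroup.LocalRing L v) * conjLocal L (IsCMField.complexConj L) v x = N * T := by
  rintro ⟨x, hx⟩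
  refine hT ⟨x * y⁻¹, ?_⟩
  set σ := conjLocal L (IsCMField.complexConj L) v with hσ
  -- `σ_v` on the inverse unit: `σ_v ↑y⁻¹ * σ_v ↑y = 1`
  have hyinv : σ (↑y⁻¹ : UnitaryGroup.LocalRing L v) * σ (y : UnitaryGroup.LocalRing L v) = 1 := by
    rw [← map_mul, Units.inv_mul, map_one]
  have hNu : IsUnit N := by
    rw [← hN]
    exact y.isUnit.mul (IsUnit.of_mul_eq_one _ (by rw [mul_comm]; exact hyinv))
  -- `(x y⁻¹) σ(x y⁻¹) · (y σy) = x σx`, i.e. `· N = N · T`; cancel the unit `N`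
  have h1 : ((x * y⁻¹ : (UnitaryGroup.LocalRing L v)ˣ) : UnitaryGroup.LocalRing L v) *
      σ ((x * y⁻¹ : (UnitaryGroup.LocalRing L v)ˣ) : UnitaryGroup.LocalRing L v) * N = N * T := by
    rw [← hx, ← hN, Units.val_mul, map_mul]
    calc (x : UnitaryGroup.LocalRing L v) * ↑y⁻¹ * (σ ↑x * σ ↑y⁻¹) * (↑y * σ ↑y)
        = (x : UnitaryGroup.LocalRing L v) * σ ↑x * ((↑y⁻¹ : UnitaryGroup.LocalRing L v) * ↑y) * (σ ↑y⁻¹ * σ ↑y) := by ring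
      _ = (x : UnitaryGroup.LocalRing L v) * σ ↑x := by rw [Units.inv_mul, hyinv, mul_one, mul_one]
  exact hNu.mul_left_cancel (by rw [mul_comm N, h1])

/-- **`ι_v(s²) = ι_v(s) · σ_v ι_v(s)` is a norm** (`σ_v` fixes `ι_v(L⁺_v)`, ★ `conjLocal_toLocalRing`). [cite: Rogawski1990, §3.8 p. 30] -/
theorem exists_units_mul_conjLocal_eq_toLocalRing_sq (s : (v.adicCompletion ↥(maximalRealSubfield L))ˣ) :
    ∃ x : (UnitaryGroup.LocalRing L v)ˣ, (x : UnitaryGroup.LocalRing L v) * conjLocal L (IsCMField.complexConj L) v x =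
      toLocalRing L v ((s : v.adicCompletion ↥(maximalRealSubfield L)) ^ 2) :=
  ⟨Units.map (toLocalRing L v : v.adicCompletion ↥(maximalRealSubfield L) →* UnitaryGroup.LocalRing L v) s,
    by rw [Units.coe_map, MonoidHom.coe_coe, conjLocal_toLocalRing, ← map_mul, sq]⟩

/-! ## §2 The glue -/

omit [IsCMField L] in
/-- **Currency**: for `t ∈ L⁺`, `algebraMap L L_v ((t : L⁺) : L) = ι_v (t : L⁺_v)` (★ `toLocalRing_coe`; the coercion `L⁺ → L` IS `algebraMap L⁺ L`). [cite: Rogawski1990, §3.8 p. 30] -/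
theorem algebraMap_coe_maximalRealSubfield_eq_toLocalRing (t : ↥(maximalRealSubfield L)) :
    algebraMap L (UnitaryGroup.LocalRing L v) (t : L) = toLocalRing L v (t : v.adicCompletion ↥(maximalRealSubfield L)) := by
  rw [toLocalRing_coe]
  rfl

/-- **(NNᴸ) THE NON-NORM CLASS GLUE.**  At a finite place `v` of `L⁺` NOT split in `L` and for every global line `ε₀ ∈ (L⁺)ˣ` there is a unit `κ` of `L⁺_v` such that EVERY global
line `a ∈ (L⁺)ˣ` lying in the square class of `κ` in `L⁺_v` (`ι a = κ · s²`, the output shape of ★ (WAᴸ-2) `Liu2021.exists_isAdmissibleElement_algebraMap_mul_eq_mul_sq … v κ`) has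
`a · ε₀⁻¹` NOT a norm from `(L ⊗ L⁺_v)ˣ` — in the currency of ★ (SCᴸ) `F0P3cDbTSupercuspidalOffOccurringClass.exists_line_forall_isSupercuspidal_xThetaCM_of_not_isNorm` ∕ ★
`u1Disjoint_of_letters`, token for token.  `κ := ι(ε₀) · κ₀`, `κ₀` a non-norm at the non-split `v` (★ `exists_not_isNorm_of_nonsplit`, local norm index 2); §1 does the rest.
So: (WAᴸ-2) at this `κ` ⟹ (SCᴸ)'s hypothesis at `a` ⟹ `X_v(μ, a, χ_f)` supercuspidal. [cite: Omeara1963, §63B Cor. 63:13a] [cite: GelbartRogawski1991, Lem. 5.1.2 p. 466]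
[cite: Liu2021, App. D §D.1 Step 2] -/
theorem exists_kappa_forall_not_isNorm_nonsplit (hns : ∀ w : PlacesOver L v, IsCMField.complexConj L • w.1 = w.1)
    (ε₀ : (↥(maximalRealSubfield L))ˣ) :
    ∃ κ : (v.adicCompletion ↥(maximalRealSubfield L))ˣ,
      ∀ (a : (↥(maximalRealSubfield L))ˣ) (s : (v.adicCompletion ↥(maximalRealSubfield L))ˣ),
        algebraMap ↥(maximalRealSubfield L) (v.adicCompletion ↥(maximalRealSubfield L)) (a : ↥(maximalRealSubfield L)) =
          (κ : v.adicCompletion ↥(maximalRealSubfield L)) * (s : v.adicCompletion ↥(maximalRealSubfield L)) ^ 2 →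
        ¬ ∃ x : (UnitaryGroup.LocalRing L v)ˣ, (x : UnitaryGroup.LocalRing L v) * conjLocal L (IsCMField.complexConj L) v x =
          algebraMap L (UnitaryGroup.LocalRing L v) (((a * ε₀⁻¹ : (↥(maximalRealSubfield L))ˣ) : ↥(maximalRealSubfield L)) : L) := by
  obtain ⟨w⟩ : Nonempty (PlacesOver L v) := inferInstance
  -- a non-norm `κ₀` of `L⁺_v` at the non-split place
  obtain ⟨κ₀, hκ₀⟩ := Liu2021.LemD1IndexedNonVacuityNonsplitPlace.exists_not_isNorm_of_nonsplit L v (IsCMField.complexConj L)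
    (UnitaryDualPair.complexConj_imagUnit L) (UnitaryDualPair.imagUnit_ne_zero L) w (hns w)
  refine ⟨Units.map (algebraMap ↥(maximalRealSubfield L) (v.adicCompletion ↥(maximalRealSubfield L)) : _ →* _) ε₀ * κ₀, fun a s ha => ?_⟩
  -- `a ε₀⁻¹ = κ₀ · s²` in `L⁺_v`
  have hε₀ : (algebraMap ↥(maximalRealSubfield L) (v.adicCompletion ↥(maximalRealSubfield L)) (ε₀ : ↥(maximalRealSubfield L))) ≠ 0 :=
    (map_ne_zero _).2 ε₀.ne_zero
  have hratio : algebraMap ↥(maximalRealSubfield L) (v.adicCompletion ↥(maximalRealSubfield L))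
      (((a * ε₀⁻¹ : (↥(maximalRealSubfield L))ˣ) : ↥(maximalRealSubfield L))) =
        (κ₀ : v.adicCompletion ↥(maximalRealSubfield L)) * (s : v.adicCompletion ↥(maximalRealSubfield L)) ^ 2 := by
    rw [Units.val_mul, map_mul, ha, Units.val_mul, Units.coe_map, MonoidHom.coe_coe, Units.val_inv_eq_inv_val, map_inv₀]
    field_simp
  -- move to `L_v` and conclude by §1
  rw [algebraMap_coe_maximalRealSubfield_eq_toLocalRing,
    show ((((a * ε₀⁻¹ : (↥(maximalRealSubfield L))ˣ) : ↥(maximalRealSubfield L)) : v.adicCompletion ↥(maximalRealSubfield L))) =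
      algebraMap ↥(maximalRealSubfield L) (v.adicCompletion ↥(maximalRealSubfield L)) (((a * ε₀⁻¹ : (↥(maximalRealSubfield L))ˣ) : ↥(maximalRealSubfield L)))
      from rfl,
    hratio, map_mul]
  obtain ⟨y, hy⟩ := exists_units_mul_conjLocal_eq_toLocalRing_sq L v s
  have hκ₀' : ¬ ∃ x : (UnitaryGroup.LocalRing L v)ˣ, (x : UnitaryGroup.LocalRing L v) * conjLocal L (IsCMField.complexConj L) v x =
      toLocalRing L v (κ₀ : v.adicCompletion ↥(maximalRealSubfield L)) := by
    rw [← algebraMap_localRing_eq]; exact hκ₀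
  have h := not_exists_mul_conjLocal_eq_mul_of_not L v hκ₀' y hy
  rwa [mul_comm] at h

/-! ## §3 The composition (WAᴸ-2) ∘ (NNᴸ) ∘ (SCᴸ): an ADMISSIBLE global line whose local theta type at `v` is SUPERCUSPIDAL -/

set_option synthInstance.maxHeartbeats 400000 in
set_option maxHeartbeats 8000000 in
/-- **ADMISSIBLE LINE WITH SUPERCUSPIDAL THETA TYPE AT A NON-SPLIT PLACE** ((WAᴸ-2) ★ ∘ (NNᴸ) §2 ∘ (SCᴸ) ★, hypothesis-free).  For a CM field `L`, a set `Φ` of complex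
embeddings with `φ ∈ Φ → φ̄ ∉ Φ` (e.g. the CM type of a conjugate-symplectic `μ`), a non-zero purely imaginary `δ ∈ L`, a real non-zero diagonal frame `dV` (reindexing `e₁`),
`μ` conjugate-symplectic, `χ_f` continuous unitary and a finite place `v` of `L⁺` NOT split in `L`: there is a global line `a ∈ (L⁺)ˣ` with `a · δ` ADMISSIBLE for `Φ`
(★ `Liu2021.IsAdmissibleElement`, the sign conditions Θ-OCC-GEN wants at the real places) AND `X_v(μ, a, χ_f)` SUPERCUSPIDAL (★ `xThetaCM … a v`) — the input of organ
(O1)'s in-house road at `v` («a line in the supercuspidal class», [GelbartRogawski1991 Lem. 5.1.2 proof p. 466: the class of `ψ′_v` off that of `ψ_v`]).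
[cite: GelbartRogawski1991, §1.4 p. 451 L1–4; Lem. 5.1.2 p. 466] [cite: Liu2021, Def. 4.12; App. D §D.1 Step 2] [cite: Omeara1963, §63B Cor. 63:13a] -/
theorem exists_isAdmissibleElement_isSupercuspidal_xThetaCM (Φ : Set (L →+* ℂ)) (hΦ : ∀ φ ∈ Φ, NumberField.ComplexEmbedding.conjugate φ ∉ Φ)
    {δ : L} (hδ : IsCMField.complexConj L δ = -δ) (hδ0 : δ ≠ 0)
    {n' : ℕ} (e₁ : Fin 3 × Fin 1 ≃ Fin n') (dV : Fin 3 → L) (hdV : ∀ i, IsCMField.complexConj L (dV i) = dV i) (hdV0 : ∀ i, dV i ≠ 0)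
    (μ : Literature.NumberTheory.Automorphic.IdeleClassGroup L →ₜ* Circle) (hμ : IsConjugateSymplectic L μ)
    (χf : UnitaryGroup.finAdelicOne (↥(maximalRealSubfield L)) L (IsCMField.complexConj L) →* ℂˣ)
    (hcont : Continuous χf) (hunit : ∀ z, ‖((χf z : ℂˣ) : ℂ)‖ = 1)
    (hns : ∀ w : PlacesOver L v, IsCMField.complexConj L • w.1 = w.1) :
    ∃ a : (↥(maximalRealSubfield L))ˣ,
      Literature.AlgebraicGeometry.Liu2021.IsAdmissibleElement L Φ (algebraMap ↥(maximalRealSubfield L) L a * δ) ∧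
      (xThetaCM L e₁ dV hdV hdV0 μ hμ χf a v).IsSupercuspidal := by
  obtain ⟨ε₀, hε₀⟩ := F0P3cDbTSupercuspidalOffOccurringClass.exists_line_forall_isSupercuspidal_xThetaCM_of_not_isNorm L e₁ dV hdV hdV0 μ hμ χf
    hcont hunit v hns
  obtain ⟨κ, hκ⟩ := exists_kappa_forall_not_isNorm_nonsplit L v hns ε₀
  obtain ⟨a, s, hadm, ha⟩ := Literature.AlgebraicGeometry.Liu2021.exists_isAdmissibleElement_algebraMap_mul_eq_mul_sq Φ hΦ hδ hδ0 v κ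
  exact ⟨a, hadm, hε₀ a (hκ a s ha)⟩

end Summit.HodgeConjecture.HodgeConjecture.Cruxes.H413.F0P3cDbTNonNormClassGlue

end
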